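import Summits.CriticalPhenomena.PercolationContinuityZ3.Theorems.PercNearOneGluingNoHeavyLowerTailSahiCTCRtThreePeelInduction
import HarnessLib

/-!
# `NoHeavyLowerTail` (crux stmt-CriticalPhenomena-4575), P3 lane: `R_3 ∈ ℕ[s]` REDUCES TO THE LOOP-FREE LOW PROFILES —
# one hypothesis (nonnegativity at profiles with entries `≤ 2`, at most two doubled points, at least one single point and every single point
# loop-free in both families) plus the finite diagonal base

Support file (seat `prim-l12-p3`, gen 46; `--supports stmt-CriticalPhenomena-4575`).  Memo
`run/shared/lean/prim/prim-l12/FROM-prim-l12-p3-g46-SIGNED-FORM-AND-EX-REFUTED.md` §1.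

Context.  Gen 45 reduced `R_3(𝒳,𝒵) ∈ ℕ[s]` (coefficientwise level-3 threshold correlation, `…SahiCTCRtForm`) to the EXCHANGE MONOTONICITY
(EX) `coeff_{n−e_u+e_s} R_3 ≤ coeff_n R_3` (`…SahiCTCRtThreeExchangeInduction`, hypothesis `hEX`).  Gen 46: **(EX) is false** at profiles with
two doubled points (seven explicit pairs of up-sets on 6 and 7 points found by gen 45's annealing adversary kit j293489 and verified by three
independent coefficient engines; smallest: `𝒳 = ↑{c, abe, f}`, `𝒵 = ↑{abd, cd, de, df}`, `n = (2,2,1,1,1,1)`, `s = d`, `u = c`: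
`coeff_n R_3 = 9 < 10 = coeff_{n−e_c+e_d} R_3`; evidence file on the item).  So `hEX` cannot be discharged and the lane needs a reduction whose
hypothesis is (conjecturally) TRUE.  THIS FILE states the honest one.  By the tree theorems (entries `≥ 3`: `coeff_Rt_three_nonneg_of_three_le`;
`≥ 4` doubled points: `coeff_Rt_three_nonneg_of_four_le_card_dbl`; drop of a single point at `3` doubled points:
`coeff_Rt_three_drop_of_three_le_card_dbl`; LOOP PEEL at a single point that is a loop of either family: `coeff_Rt_three_loopPeel(')`) and the
induction on the number of single points of `…SahiCTCRtThreePeelInduction`, **`R_3(𝒳,𝒵) ∈ ℕ[s]` for every pair of up-sets on `α` follows from**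
* `hLF` : `0 ≤ coeff_n R_3(𝒳',𝒵')` for all up-sets `𝒳', 𝒵'` on `α` and every profile `n` with entries `≤ 2`, `#dbl n ≤ 2`, at least one single
  point, and every single point `u` LOOP-FREE (`{u} ∉ 𝒳'`, `{u} ∉ 𝒵'`) — the "rows 0, 1, 2 with loop-free singles" (0.4·10⁹ exact instances of
  the lane's censuses, no failure; gen 46 proves row 0 when a common loop lies in the support and gives the signed 3-partition form (SQF) of these
  coefficients, memo §2–§4);
* `hB` : the diagonal base (entries in `{0,2}`, `≤ 3` doubled points; a finite check on `≤ 3` points, memo g44 §1),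
(`coeff_Rt_three_nonneg_of_loopFree`).  Compared with `coeff_Rt_three_nonneg_of_peels` (gen 44) the three conjectural peel hypotheses are replaced
by the plain nonnegativity on their common domain; compared with `…_of_exchange` (gen 45) the refuted (EX) is gone.  Nothing is asserted about the
crux; `hLF` and `hB` are NOT proved here.
-/

noncomputable section

open scoped Classical

namespace Summit.CriticalPhenomena.PercolationContinuityZ3.Theorems.SahiCTCForms

open Finset MvPolynomial SahiCTCGenFun

variable {α : Type*} [DecidableEq α] [Fintype α]

/-- **`R_3 ∈ ℕ[s]` FROM THE LOOP-FREE LOW PROFILES.**  If `coeff_n R_3(𝒳',𝒵') ≥ 0` for all pairs of up-sets on `α` at every profile `n` with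
entries `≤ 2`, at most two doubled points, at least one single point and all single points loop-free in both families (`hLF`), and the diagonal
base holds (`hB`), then `R_3(𝒳,𝒵) ∈ ℕ[s]` for every pair of up-sets `𝒳, 𝒵` on `α`.  Induction on the number of single points: entries `≥ 3`,
`≥ 4` doubled points and the drop at `3` doubled points are tree theorems, a single loop point peels by `coeff_Rt_three_loopPeel(')`
(memo g46 §1). [this work] -/
theorem coeff_Rt_three_nonneg_of_loopFree
    -- rows 0–2 with loop-free single points
    (hLF : ∀ (F G : Finset (Finset α)), IsUpperSet (F : Set (Finset α)) → IsUpperSet (G : Set (Finset α)) →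
      ∀ (n : α →₀ ℕ), (∀ i, n i ≤ 2) → #(dbl n) ≤ 2 → (∃ s, n s = 1) →
        (∀ u, n u = 1 → ({u} : Finset α) ∉ F ∧ ({u} : Finset α) ∉ G) → 0 ≤ (Rt 3 F G).coeff n)
    -- diagonal base: entries in {0,2}, at most three doubled points
    (hB : ∀ (F G : Finset (Finset α)), IsUpperSet (F : Set (Finset α)) → IsUpperSet (G : Set (Finset α)) →
      ∀ (n : α →₀ ℕ), (∀ i, n i = 0 ∨ n i = 2) → #(dbl n) ≤ 3 → 0 ≤ (Rt 3 F G).coeff n)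
    {F G : Finset (Finset α)} (hF : IsUpperSet (F : Set (Finset α))) (hG : IsUpperSet (G : Set (Finset α))) (n : α →₀ ℕ) :
    0 ≤ (Rt 3 F G).coeff n := by
  -- strong induction on the number of single points, for all pairs of up-sets simultaneously
  suffices key : ∀ k : ℕ, ∀ (F G : Finset (Finset α)), IsUpperSet (F : Set (Finset α)) → IsUpperSet (G : Set (Finset α)) →
      ∀ n : α →₀ ℕ, #(n.support.filter fun i => n i = 1) = k → 0 ≤ (Rt 3 F G).coeff n from key _ F G hF hG n rfl
  intro k
  induction k using Nat.strong_induction_on with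
  | _ k ih =>
  intro F G hF hG n hk
  -- an entry ≥ 3: unconditional
  by_cases h3 : ∃ w, 3 ≤ n w
  · obtain ⟨w, hw⟩ := h3; exact coeff_Rt_three_nonneg_of_three_le hF hG hw
  have h2 : ∀ i, n i ≤ 2 := fun i => by by_contra h; exact h3 ⟨i, by omega⟩
  -- four doubled points: unconditional
  by_cases h4 : 4 ≤ #(dbl n)
  · exact coeff_Rt_three_nonneg_of_four_le_card_dbl hF hG h4
  -- no single point: the diagonal base
  by_cases h0 : #(n.support.filter fun i => n i = 1) = 0
  · exact hB F G hF hG n (eq_zero_or_two_of_ones_eq_zero h2 h0) (by omega)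
  obtain ⟨s, hs⟩ := exists_single_of_ones_ne_zero h0
  -- the two induction instances at a single point `t`
  have ihDown : ∀ {t : α}, n t = 1 → 0 ≤ (Rt 3 F G).coeff (n - Finsupp.single t 1) := fun {t} ht =>
    ih _ (by rw [← hk, ← ones_tsub_single ht]; omega) F G hF hG _ rfl
  have ihUp : ∀ {t : α}, n t = 1 → 0 ≤ (Rt 3 F G).coeff (n + Finsupp.single t 1) := fun {t} ht =>
    ih _ (by rw [← hk, ← ones_add_single ht]; omega) F G hF hG _ rfl
  -- three doubled points: drop `s`
  by_cases hd3 : 3 ≤ #(dbl n)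
  · exact (ihDown hs).trans (coeff_Rt_three_drop_of_three_le_card_dbl hF hG hs hd3)
  have hd2 : #(dbl n) ≤ 2 := by omega
  -- a single point that is a loop of either family: loop peel
  by_cases hloop : ∃ t, n t = 1 ∧ (({t} : Finset α) ∈ F ∨ ({t} : Finset α) ∈ G)
  · obtain ⟨t, ht, htl⟩ := hloop
    set m := n - Finsupp.single t 1 with hm
    have hmt : m t = 0 := by rw [hm, Finsupp.tsub_apply, Finsupp.single_eq_same, ht]
    have hn : n = m + Finsupp.single t 1 := by rw [hm, tsub_add_cancel_of_le]; rw [Finsupp.single_le_iff, ht]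
    have hpeel : (Rt 3 F G).coeff (m + Finsupp.single t 2) + (Rt 3 F G).coeff m ≤ (Rt 3 F G).coeff (m + Finsupp.single t 1) := by
      rcases htl with h | h
      · exact coeff_Rt_three_loopPeel hF hG h hmt
      · exact coeff_Rt_three_loopPeel' hF hG h hmt
    have hup : n + Finsupp.single t 1 = m + Finsupp.single t 2 := by rw [hn, add_assoc, ← Finsupp.single_add]
    have h1 := ihUp ht
    have h0' := ihDown ht
    rw [hup] at h1; rw [← hm] at h0'; rw [hn]
    linarith
  -- otherwise every single point is loop-free in both families: the hypothesis
  exact hLF F G hF hG n h2 hd2 ⟨s, hs⟩ fun u hu => ⟨fun h => hloop ⟨u, hu, Or.inl h⟩, fun h => hloop ⟨u, hu, Or.inr h⟩⟩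

end Summit.CriticalPhenomena.PercolationContinuityZ3.Theorems.SahiCTCForms
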